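import Literature.AlgebraicGeometry.Modules.QuasicoherentAbelian
import Literature.AlgebraicGeometry.Modules.PushforwardAffineExact
import Literature.AlgebraicGeometry.Morphisms.FormalFunctionsModule
import Literature.AlgebraicGeometry.Morphisms.CechModuleShortExact
import Literature.AlgebraicGeometry.Modules.SectionsExact
import Mathlib.Algebra.Homology.ShortComplex.HomologicalComplex
import HarnessLib

/-!
# The homology sheaves of a complex of quasi-coherent modules: quasi-coherence, and sections over an
# affine open = homology of the sections (Hartshorne II Prop. 5.6 / 5.7, III Prop. 8.5; Stacks 01LA, 01XB)

For a scheme `X` and a homological complex `K` of `𝒪_X`-modules (any shape) all of whose terms are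
affine-localizing (`Modules/AffineLocalizing`: the section-level form of quasi-coherence, EGA I 1.4.1 d1),
d2); `= IsQuasicoherent` by `Modules/QuasicoherentAbelian`; images affine-localizing by
`Modules/PushforwardAffineExact.isAffineLocalizing_image`), this file proves:

* §1 cokernels on affine opens — for `φ : M → N` between affine-localizing modules and an AFFINE open
  `V`, `Γ(V, N) → Γ(V, coker φ)` is surjective with kernel the image of `Γ(V, M)`
  (`cokernel_π_app_surjective`, `cokernel_π_app_eq_zero_iff`; Hartshorne II Prop. 5.6: `Γ(V, –)` is
  exact on quasi-coherent modules over an affine `V`), transported to any colimit cokernel cofork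
  (`Cofork.π_app_surjective_of_isColimit`, `Cofork.π_app_eq_zero_iff_of_isColimit`) and, dually and on
  every open, kernel forks (`Fork.ι_app_injective_of_isLimit`, `Fork.exists_ι_app_eq_of_isLimit`);
* §2 **`isAffineLocalizing_cycles`, `isAffineLocalizing_homology`** — the cycles `Zⁱ = ker dⁱ` and the
  homology modules `Hⁱ(K)` (Mathlib's `K.cycles i`, `K.homology i`) are affine-localizing (Stacks 01LA:
  kernels and cokernels of quasi-coherent modules are quasi-coherent);
* §3 **sections over an affine open** — `Γ(V, Zⁱ) ↪ Γ(V, Kⁱ)` is the kernel of `Γ(V, dⁱ)` (every open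
  `V`: `iCycles_app_injective`, `exists_iCycles_app_eq`), and for `V` AFFINE, `Γ(V, Zʲ) → Γ(V, Hʲ(K))` is
  SURJECTIVE with kernel the image of `Γ(V, Kⁱ) → Γ(V, Zʲ)` (`homologyπ_app_surjective`,
  `homologyπ_app_eq_zero_iff`): **`Γ(V, Hʲ(K)) = Hʲ(Γ(V, K•))`** (Hartshorne III Prop. 8.5, the affine
  computation of higher direct images; Stacks 01XB).

Everything is proved; no named facts; no instances. Written as step D of the discharge of the named fact
`Modules/BoundedCoherentVBModels.Grothendieck_higherDirectImage_coh` (EGA III 3.2.1): the higher direct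
images of a coherent sheaf under a proper morphism are the homology sheaves of the direct image of an
ordered Čech complex, a complex of quasi-coherent modules. Nothing here bears on any summit statement.
Mathlib searched (pin): `HomologicalComplex.cyclesIsKernel`, `homologyIsCokernel`, `toCycles_i`,
`kernelIsKernel`, `cokernelIsCokernel`, `IsLimit.conePointUniqueUpToIso` (used); Mathlib has no
quasi-coherence or section computation for homology sheaves on schemes.

## References

* R. Hartshorne, *Algebraic Geometry*, GTM 52 (1977): II Prop. 5.6, Prop. 5.7 (pp. 113–114), III Prop. 8.5
  (p. 251). [Hartshorne1977]
* The Stacks Project, Tag 01LA (kernels/cokernels of quasi-coherent modules), Tag 01XB (cohomology of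
  quasi-coherent modules on affines). [StacksProject]
-/

noncomputable section

-- `TopCat.Presheaf`/`Scheme.Modules` are not reducible (as in Mathlib's `AlgebraicGeometry/Modules/Sheaf.lean`).
set_option backward.isDefEq.respectTransparency false

open CategoryTheory CategoryTheory.Limits AlgebraicGeometry TopologicalSpace Opposite

universe u

namespace Literature.AlgebraicGeometry.Modules

open Literature.AlgebraicGeometry.Morphisms

variable {X : Scheme.{u}}

/-! ## §1 Cokernels and kernels on sections -/

section Cokernel

variable {M N : X.Modules} (φ : M ⟶ N)

/-- **`Γ(V, N) → Γ(V, coker φ)` is surjective on an affine open `V`** for `φ : M → N` between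
affine-localizing modules (`H¹(V, im φ) = 0`). [cite: Hartshorne1977, II Prop. 5.6 (p. 113)] [cite: StacksProject, Tag 01XB] -/
theorem cokernel_π_app_surjective (hM : IsAffineLocalizing M) (hN : IsAffineLocalizing N) {V : X.Opens}
    (hV : IsAffineOpen V) : Function.Surjective ((cokernel.π φ).app V) :=
  app_surjective_of_shortExact (shortExact_imageι_cokernelπ φ) (isAffineLocalizing_image φ hM hN) hV

/-- **The kernel of `Γ(V, N) → Γ(V, coker φ)` is the image of `Γ(V, M)`** on an affine open `V`, for
`φ : M → N` between affine-localizing modules (left exactness of sections on `0 → im φ → N → coker φ`,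
and surjectivity of `Γ(V, M) → Γ(V, im φ)`, the kernel `ker φ` being affine-localizing).
[cite: Hartshorne1977, II Prop. 5.6 (p. 113)] -/
theorem cokernel_π_app_eq_zero_iff (hM : IsAffineLocalizing M) (hN : IsAffineLocalizing N) {V : X.Opens}
    (hV : IsAffineOpen V) (n : Γ(N, V)) :
    (cokernel.π φ).app V n = 0 ↔ ∃ m : Γ(M, V), φ.app V m = n := by
  refine ⟨fun hn => ?_, ?_⟩
  · obtain ⟨i, hi⟩ := (sections_exact_of_shortExact (shortExact_imageι_cokernelπ φ) V).2 n hn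
    obtain ⟨m, hm⟩ := app_surjective_of_shortExact (shortExact_kernel_factorThruImage φ)
      (hM.kernel φ hN) hV i
    refine ⟨m, ?_⟩
    have hm' : (Abelian.factorThruImage φ).app V m = i := hm
    have hi' : (Abelian.image.ι φ).app V i = n := hi
    calc φ.app V m = (Abelian.factorThruImage φ ≫ Abelian.image.ι φ).app V m := by
          rw [Abelian.image.fac]
      _ = (Abelian.image.ι φ).app V ((Abelian.factorThruImage φ).app V m) := rfl
      _ = n := by rw [hm', hi']
  · rintro ⟨m, rfl⟩
    exact app_app_eq_zero (ShortComplex.mk φ (cokernel.π φ) (cokernel.condition φ)) V m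

variable {φ}

/-- Transport to an arbitrary colimit cokernel cofork: its projection is surjective on the sections over
an affine open (for `φ` between affine-localizing modules). [cite: Hartshorne1977, II Prop. 5.6 (p. 113)] -/
theorem Cofork.π_app_surjective_of_isColimit {c : CokernelCofork φ} (hc : IsColimit c)
    (hM : IsAffineLocalizing M) (hN : IsAffineLocalizing N) {V : X.Opens} (hV : IsAffineOpen V) :
    Function.Surjective (c.π.app V) := by
  let e : cokernel φ ≅ c.pt := (cokernelIsCokernel φ).coconePointUniqueUpToIso hc
  have he : cokernel.π φ ≫ e.hom = c.π :=
    (cokernelIsCokernel φ).comp_coconePointUniqueUpToIso_hom hc WalkingParallelPair.one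
  intro y
  obtain ⟨n, hn⟩ := cokernel_π_app_surjective φ hM hN hV (e.inv.app V y)
  refine ⟨n, ?_⟩
  rw [← he]
  change e.hom.app V ((cokernel.π φ).app V n) = y
  rw [hn, hom_app_inv_app]

/-- Transport to an arbitrary colimit cokernel cofork: on an affine open, a section dies under the
projection iff it comes from `Γ(V, M)`. [cite: Hartshorne1977, II Prop. 5.6 (p. 113)] -/
theorem Cofork.π_app_eq_zero_iff_of_isColimit {c : CokernelCofork φ} (hc : IsColimit c)
    (hM : IsAffineLocalizing M) (hN : IsAffineLocalizing N) {V : X.Opens} (hV : IsAffineOpen V)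
    (n : Γ(N, V)) : c.π.app V n = 0 ↔ ∃ m : Γ(M, V), φ.app V m = n := by
  let e : cokernel φ ≅ c.pt := (cokernelIsCokernel φ).coconePointUniqueUpToIso hc
  have he : cokernel.π φ ≫ e.hom = c.π :=
    (cokernelIsCokernel φ).comp_coconePointUniqueUpToIso_hom hc WalkingParallelPair.one
  rw [← cokernel_π_app_eq_zero_iff φ hM hN hV n, ← he]
  change e.hom.app V ((cokernel.π φ).app V n) = 0 ↔ _
  constructor
  · intro h
    have := congrArg (e.inv.app V) h
    rwa [inv_app_hom_app, map_zero] at this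
  · intro h
    rw [h, map_zero]

end Cokernel

section Kernel

variable {M N : X.Modules} {φ : M ⟶ N}

/-- Transport to an arbitrary limit kernel fork: its inclusion is injective on sections (every open).
[cite: Hartshorne1977, II Ex. 1.8 (p. 66)] -/
theorem Fork.ι_app_injective_of_isLimit {c : KernelFork φ} (hc : IsLimit c) (V : X.Opens) :
    Function.Injective (c.ι.app V) := by
  let e := hc.conePointUniqueUpToIso (kernelIsKernel φ)
  have he : e.hom ≫ kernel.ι φ = c.ι :=
    hc.conePointUniqueUpToIso_hom_comp (kernelIsKernel φ) WalkingParallelPair.zero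
  rw [← he]
  intro a b hab
  change (kernel.ι φ).app V (e.hom.app V a) = (kernel.ι φ).app V (e.hom.app V b) at hab
  have h := kernel_ι_app_injective φ V hab
  have := congrArg (e.inv.app V) h
  rwa [inv_app_hom_app, inv_app_hom_app] at this

/-- Transport to an arbitrary limit kernel fork: a section of `M` killed by `φ` comes from the fork
(every open). [cite: Hartshorne1977, II Ex. 1.8 (p. 66)] -/
theorem Fork.exists_ι_app_eq_of_isLimit {c : KernelFork φ} (hc : IsLimit c) (V : X.Opens) (m : Γ(M, V))
    (hm : φ.app V m = 0) : ∃ z : Γ(c.pt, V), c.ι.app V z = m := by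
  let e := hc.conePointUniqueUpToIso (kernelIsKernel φ)
  have he : e.hom ≫ kernel.ι φ = c.ι :=
    hc.conePointUniqueUpToIso_hom_comp (kernelIsKernel φ) WalkingParallelPair.zero
  obtain ⟨m', hm'⟩ := exists_kernel_ι_app_eq φ V m hm
  refine ⟨e.inv.app V m', ?_⟩
  rw [← he]
  change (kernel.ι φ).app V (e.hom.app V (e.inv.app V m')) = m
  rw [hom_app_inv_app, hm']

/-- `φ ∘ ι = 0` on the sections of a kernel fork. [cite: Hartshorne1977, II Ex. 1.8 (p. 66)] -/
theorem Fork.app_ι_app (c : KernelFork φ) (V : X.Opens) (z : Γ(c.pt, V)) : φ.app V (c.ι.app V z) = 0 := by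
  change (c.ι ≫ φ).app V z = 0
  rw [KernelFork.condition]
  rfl

end Kernel

/-! ## §2 Cycles and homology of a complex of affine-localizing modules are affine-localizing -/

section Complex

variable {ι : Type*} {c : ComplexShape ι} (K : HomologicalComplex X.Modules c)

/-- **The cycles `Zⁱ = ker(dⁱ)` of a complex of affine-localizing modules are affine-localizing.**
[cite: StacksProject, Tag 01LA] [cite: Hartshorne1977, II Prop. 5.7 (p. 114)] -/
theorem isAffineLocalizing_cycles (hK : ∀ i, IsAffineLocalizing (K.X i)) (i : ι) :
    IsAffineLocalizing (K.cycles i) := by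
  let e := (K.cyclesIsKernel i (c.next i) rfl).conePointUniqueUpToIso (kernelIsKernel (K.d i (c.next i)))
  exact IsAffineLocalizing.of_iso e.symm ((hK i).kernel _ (hK _))

/-- **The homology modules `Hⁱ(K)` of a complex of affine-localizing modules are affine-localizing**
(`Hⁱ = coker(Kⁱ⁻¹ → Zⁱ)`). [cite: StacksProject, Tag 01LA] [cite: Hartshorne1977, II Prop. 5.7 (p. 114)] -/
theorem isAffineLocalizing_homology (hK : ∀ i, IsAffineLocalizing (K.X i)) (i : ι) :
    IsAffineLocalizing (K.homology i) := by
  let e : cokernel (K.toCycles (c.prev i) i) ≅ K.homology i :=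
    (cokernelIsCokernel _).coconePointUniqueUpToIso (K.homologyIsCokernel (c.prev i) i rfl)
  exact IsAffineLocalizing.of_iso e
    (IsAffineLocalizing.cokernel _ (hK _) (isAffineLocalizing_cycles K hK i))

/-! ## §3 Sections: `Γ(V, Zⁱ) = ker Γ(V, dⁱ)` on every open, `Γ(V, Hʲ) = Γ(V, Zʲ) / im Γ(V, Kⁱ)` on affines -/

/-- `Γ(V, Zⁱ) → Γ(V, Kⁱ)` is injective. [cite: Hartshorne1977, II Ex. 1.8 (p. 66)] -/
theorem iCycles_app_injective (i : ι) (V : X.Opens) : Function.Injective ((K.iCycles i).app V) :=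
  Fork.ι_app_injective_of_isLimit (K.cyclesIsKernel i (c.next i) rfl) V

/-- `dⁱ ∘ (Zⁱ ↪ Kⁱ) = 0` on sections. [cite: Hartshorne1977, III §1 p. 203 (cycles and homology of a complex)] -/
theorem d_app_iCycles_app (i j : ι) (V : X.Opens) (z : Γ(K.cycles i, V)) :
    (K.d i j).app V ((K.iCycles i).app V z) = 0 := by
  change (K.iCycles i ≫ K.d i j).app V z = 0
  rw [HomologicalComplex.iCycles_d]
  rfl

/-- **`Γ(V, Zⁱ)` is the kernel of `Γ(V, dⁱ)`**: a section of `Kⁱ` over `V` killed by `dⁱ : Kⁱ → Kʲ`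
(`j = c.next i`) is (uniquely) a section of `Zⁱ`. [cite: Hartshorne1977, II Ex. 1.8 (p. 66)] -/
theorem exists_iCycles_app_eq (i j : ι) (hij : c.next i = j) (V : X.Opens) (x : Γ(K.X i, V))
    (hx : (K.d i j).app V x = 0) : ∃ z : Γ(K.cycles i, V), (K.iCycles i).app V z = x :=
  Fork.exists_ι_app_eq_of_isLimit (K.cyclesIsKernel i j hij) V x hx

/-- `(Zʲ ↪ Kʲ) ∘ (Kⁱ → Zʲ) = dⁱ` on sections. [cite: Hartshorne1977, III §1 p. 203 (cycles and homology of a complex)] -/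
theorem iCycles_app_toCycles_app (i j : ι) (V : X.Opens) (x : Γ(K.X i, V)) :
    (K.iCycles j).app V ((K.toCycles i j).app V x) = (K.d i j).app V x := by
  change (K.toCycles i j ≫ K.iCycles j).app V x = _
  rw [HomologicalComplex.toCycles_i]

/-- `(Zʲ → Hʲ) ∘ (Kⁱ → Zʲ) = 0` on sections. [cite: Hartshorne1977, III §1 p. 203 (cycles and homology of a complex)] -/
theorem homologyπ_app_toCycles_app (i j : ι) (V : X.Opens) (x : Γ(K.X i, V)) :
    (K.homologyπ j).app V ((K.toCycles i j).app V x) = 0 := by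
  change (K.toCycles i j ≫ K.homologyπ j).app V x = 0
  rw [HomologicalComplex.toCycles_comp_homologyπ]
  rfl

variable {K}

/-- **`Γ(V, Zʲ) → Γ(V, Hʲ(K))` is surjective on an AFFINE open `V`** when all terms of `K` are
affine-localizing. [cite: Hartshorne1977, III Prop. 8.5 (p. 251)] [cite: StacksProject, Tag 01XB] -/
theorem homologyπ_app_surjective (hK : ∀ i, IsAffineLocalizing (K.X i)) (j : ι) {V : X.Opens}
    (hV : IsAffineOpen V) : Function.Surjective ((K.homologyπ j).app V) :=
  Cofork.π_app_surjective_of_isColimit (K.homologyIsCokernel (c.prev j) j rfl) (hK _)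
    (isAffineLocalizing_cycles K hK j) hV

/-- **`Γ(V, Hʲ(K)) = Γ(V, Zʲ) / im(Γ(V, Kⁱ) → Γ(V, Zʲ))` on an AFFINE open `V`** (`i = c.prev j`): a
section of `Zʲ` dies in `Γ(V, Hʲ)` iff it is the image of a section of `Kⁱ`; with
`homologyπ_app_surjective`, `iCycles_app_injective` and `exists_iCycles_app_eq` this says that the sections
of the homology sheaf over an affine open are the homology of the complex of sections.
[cite: Hartshorne1977, III Prop. 8.5 (p. 251)] [cite: StacksProject, Tag 01XB] -/
theorem homologyπ_app_eq_zero_iff (hK : ∀ i, IsAffineLocalizing (K.X i)) (i j : ι) (hij : c.prev j = i)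
    {V : X.Opens} (hV : IsAffineOpen V) (z : Γ(K.cycles j, V)) :
    (K.homologyπ j).app V z = 0 ↔ ∃ x : Γ(K.X i, V), (K.toCycles i j).app V x = z :=
  Cofork.π_app_eq_zero_iff_of_isColimit (K.homologyIsCokernel i j hij) (hK _)
    (isAffineLocalizing_cycles K hK j) hV z

end Complex

end Literature.AlgebraicGeometry.Modules

end
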